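import Mathlib.NumberTheory.ModularForms.CongruenceSubgroups
import Mathlib.Tactic.Module
import Mathlib.Tactic.LinearCombination
import HarnessLib

/-!
# `Γ₀(N) → U(Y × Ŷ)`: the polarisation frame of exponent `N` inside `End(Y × Ŷ)` (algebraic core)

Venture cell `pub-hsemireg`, literature seat `lit-w-polishchuk-orlov`; companion of
`OrlovIsometryGroupCM.lean` / `OrlovIsometryGroupCMQuadratic.lean`. KERNEL leg of the READING marked ×0 in
the cell's locator sheet (`widen/LIT-W/LITW-POLISHCHUK-ORLOV-LOCATOR-SHEET.md` §D8 (P1)): «on EVERY complex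
polarised abelian variety `(Y, L)` of primitive type `(1, d₂, …, d_g)` one has `U(Y × Ŷ) ⊇ Γ₀(d_g)` — a
three-line matrix check from Orlov's definition plus Lange's dual polarisation», used by the W5 rows as the
hypothesis (AUT_δ) «`U(Y × Ŷ) ⊇ Γ₀(d₆)` acting through `ρ`». This file proves the three-line matrix check
in the ring where it lives, for ANY ring `S` (standing for `End(Y × Ŷ)`, non-commutative in general):
nothing here constructs an abelian variety, and nothing here says that HC, HC_CM or HC_AV holds.

## Sources, verbatim

* [Orlov2002DerivedAbelian] D. O. Orlov, *Derived categories of coherent sheaves on Abelian varieties and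
  equivalences between them*, Izv. Math. 66:3 (2002) 569–594, quoted from the PRINTED journal text (cell
  carrier `lit/Orlov2002-IzvMath66-mathnet-lit3-g38/`, `p.NNN Lnn` = printed page : line of its text layer;
  numbering identical with the held arXiv text `paper:arxiv-alg-geom_9712017`, whose translation wording
  differs cosmetically). p.583 L3–28, before **Def. 2.17**: `f = (α β; γ δ) : A × Â → B × B̂`,
  "`f̃ = (δ̂ −β̂; −γ̂ α̂)`. We define a set `U(A × Â, B × B̂)` as the subset of all `f` in
  `Iso(A × Â, B × B̂)` such that `f̃` coincides with the inverse of `f`, that is,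
  `U(A × Â, B × B̂) := {f ∈ Iso(A × Â, B × B̂) | f̃ = f⁻¹}`. If `B = A`, we denote this set by
  `U(A × Â)`. We note that `U(A × Â)` is a subgroup of `Aut(A × Â)`." **Definition 2.17** (p.583
  L29–32): "An isomorphism `f : A × Â ⥲ B × B̂` is said to be isometric if it belongs to
  `U(A × Â, B × B̂)`." **Example 4.16** (p.593 L33–37): "Consider an Abelian variety `A` with
  endomorphism ring `End(A) = ℤ`. Then the Néron–Severi group `NS(A)` is isomorphic to `ℤ`. We denote
  by `L` and `M` the generators of `NS(A)` and `NS(Â)` respectively. The composition `φ_M ∘ φ_L` is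
  equal to `N id_A` for some `N > 0`. The group `U(A × Â)` coincides with the congruence subgroup
  `Γ₀(N) ⊂ SL(2, ℤ)`."
* [Lange2023AbelianVarietiesComplex] H. Lange, *Abelian Varieties over the Complex Numbers* (Springer 2023),
  Prop. 2.5.1 (the dual polarisation; cell sheet §D8, read ×2 across seats): for a polarisation `L` of type
  `(d₁, …, d_g)` on `X` "There is a unique polarization `L_δ` on `X̂` … (ii) `φ_{L_δ} φ_L = d₁d_g 1_X`."

## The model and what is proved (DERIVED algebra; the geometric dictionary is cited, not typed)

Dictionary: `S = End(Y × Ŷ)`; `e = 1_Y`, `e' = 1_Ŷ` (the two projectors, `e + e' = 1`, `e e' = e' e = 0`);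
`φ = φ_L ∈ Hom(Y, Ŷ) = e' S e`, `ψ = φ_{L_δ} ∈ Hom(Ŷ, Y) = e S e'` with `ψ φ = N · 1_Y` (Lange 2.5.1 (ii),
`d₁ = 1`, `N = d_g`) and `φ ψ = N · 1_Ŷ` (which follows from (ii): `(φ ψ − N) φ = 0` and the isogeny `φ` is
an epimorphism). For `γ = (a b; c d) ∈ Γ₀(N)`
(`N ∣ c`) the cell's frame is `ρ(γ) := a · 1_Y + b · ψ + (c/N) · φ + d · 1_Ŷ`, and — polarisation isogenies
being self-dual and integers central — Orlov's `ρ(γ)̃ = d · 1_Y − b · ψ − (c/N) · φ + a · 1_Ŷ = ρ(γ⁻¹)`.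
PROVED here, for every ring `S`, elements `e e' φ ψ` with these relations and every `N : ℤ`:
* `polFrame_mul`: `ρ` is multiplicative for the Eichler-order product
  `(a b; Nc′ d)(a₂ b₂; Nc₂′ d₂)` (sixteen products of `e, ψ, φ, e'` reduce by the relations);
* `polFrame_mul_tilde_eq_smul_one`: `ρ · ρ̃ = (a d − N b c′) · 1` for all integers (the sheet's reading
  «`f·f̃ = (ad − d₆bc)·1`»); `polFrame_mul_tilde`, `polFrame_tilde_mul`: if `a d − N b c′ = 1` then `ρ · ρ̃ = 1 = ρ̃ · ρ`, i.e. `ρ(γ)`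
  is Orlov-isometric with inverse `ρ(γ⁻¹)` — the three-line check behind «`U(Y × Ŷ) ⊇ Γ₀(N)`»;
* `exists_monoidHom_Gamma0`: for `N ≥ 1` these assemble into a group homomorphism
  `Γ₀(N) →* Sˣ` (Mathlib's `CongruenceSubgroup.Gamma0 N`) with the displayed formula.
NOT here: the converse «`U ⊆ Γ₀(N)`», which needs `End(A) = ℤ` (Ex. 4.16's hypothesis; false at CM /
Weil-type fibres, where `U` is larger — see the companion files); injectivity of `ρ`; anything geometric.
-/

namespace Summit.Ventures.HSemireg

open scoped MatrixGroups

variable {S : Type*} [Ring S]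

section Frame

variable {e e' φ ψ : S} {N : ℤ}

/-- The sixteen products of the frame `e, ψ, φ, e'` from the seven relations (projectors splitting `1`,
`ψ ∈ e S e'`, `φ ∈ e' S e`, `ψ φ = N e`, `φ ψ = N e'`). [folklore] -/
private theorem frame_products (h1 : e + e' = 1) (h2 : e * e' = 0) (h3 : e' * e = 0)
    (hψ₁ : e * ψ = ψ) (hψ₂ : ψ * e' = ψ) (hφ₁ : e' * φ = φ) (hφ₂ : φ * e = φ) :
    e * e = e ∧ e * φ = 0 ∧ ψ * e = 0 ∧ ψ * ψ = 0 ∧ φ * φ = 0 ∧ φ * e' = 0 ∧ e' * ψ = 0 ∧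
      e' * e' = e' := by
  have he : e * e = e := by
    have : e * (e + e') = e := by rw [h1, mul_one]
    rwa [mul_add, h2, add_zero] at this
  have he' : e' * e' = e' := by
    have : (e + e') * e' = e' := by rw [h1, one_mul]
    rwa [add_mul, h2, zero_add] at this
  refine ⟨he, ?_, ?_, ?_, ?_, ?_, ?_, he'⟩
  · rw [← hφ₁, ← mul_assoc, h2, zero_mul]
  · rw [← hψ₂, mul_assoc, h3, mul_zero]
  · have h : ψ * ψ = ψ * e' * (e * ψ) := by rw [hψ₂, hψ₁]
    rw [h, mul_assoc, ← mul_assoc e', h3, zero_mul, mul_zero]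
  · have h : φ * φ = φ * e * (e' * φ) := by rw [hφ₂, hφ₁]
    rw [h, mul_assoc, ← mul_assoc e, h2, zero_mul, mul_zero]
  · rw [← hφ₂, mul_assoc, h2, mul_zero]
  · rw [← hψ₁, ← mul_assoc, h3, zero_mul]

/-- **The frame is multiplicative** for the Eichler-order product: with
`ρ(a, b, c′, d) := a·e + b·ψ + c′·φ + d·e'` (the cell's `ρ(γ)`, `γ = (a b; Nc′ d)`),
`ρ(a,b,c′,d) ρ(a₂,b₂,c₂′,d₂) = ρ(a a₂ + N b c₂′, a b₂ + b d₂, c′ a₂ + d c₂′, N c′ b₂ + d d₂)`, which are the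
entries of `(a b; Nc′ d)(a₂ b₂; Nc₂′ d₂)`. DERIVED algebra behind [cite: Orlov2002DerivedAbelian, Ex 4.16]. -/
theorem polFrame_mul (h1 : e + e' = 1) (h2 : e * e' = 0) (h3 : e' * e = 0)
    (hψ₁ : e * ψ = ψ) (hψ₂ : ψ * e' = ψ) (hφ₁ : e' * φ = φ) (hφ₂ : φ * e = φ)
    (hN₁ : ψ * φ = N • e) (hN₂ : φ * ψ = N • e') (a b c' d a₂ b₂ c₂' d₂ : ℤ) :
    (a • e + b • ψ + c' • φ + d • e') * (a₂ • e + b₂ • ψ + c₂' • φ + d₂ • e') =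
      (a * a₂ + N * b * c₂') • e + (a * b₂ + b * d₂) • ψ + (c' * a₂ + d * c₂') • φ +
        (N * c' * b₂ + d * d₂) • e' := by
  obtain ⟨hee, heφ, hψe, hψψ, hφφ, hφe', he'ψ, he'e'⟩ := frame_products h1 h2 h3 hψ₁ hψ₂ hφ₁ hφ₂
  simp only [mul_add, add_mul, smul_mul_assoc, mul_smul_comm, smul_smul, hee, heφ, h2, hψ₁, hψe, hψψ,
    hN₁, hψ₂, hφ₂, hN₂, hφφ, hφe', h3, he'ψ, hφ₁, he'e', smul_zero, add_zero, zero_add]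
  module

/-- **`ρ · ρ̃ = (a d − N b c′) · 1`** for ALL integers `a b c′ d`: the frame element times Orlov's tilde
`ρ̃ = d·e − b·ψ − c′·φ + a·e'` is the scalar `a d − N b c′` (the determinant of `(a b; Nc′ d)`) — the
sheet's three-line READING «`f·f̃ = (ad − d₆bc)·1_{Y×Ŷ}`», now kernel-checked algebra. DERIVED from
[cite: Orlov2002DerivedAbelian, Def 2.17]. -/
theorem polFrame_mul_tilde_eq_smul_one (h1 : e + e' = 1) (h2 : e * e' = 0) (h3 : e' * e = 0)
    (hψ₁ : e * ψ = ψ) (hψ₂ : ψ * e' = ψ) (hφ₁ : e' * φ = φ) (hφ₂ : φ * e = φ)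
    (hN₁ : ψ * φ = N • e) (hN₂ : φ * ψ = N • e') (a b c' d : ℤ) :
    (a • e + b • ψ + c' • φ + d • e') * (d • e + (-b) • ψ + (-c') • φ + a • e') =
      (a * d - N * b * c') • (1 : S) := by
  rw [polFrame_mul h1 h2 h3 hψ₁ hψ₂ hφ₁ hφ₂ hN₁ hN₂, ← h1]
  module

/-- **`ρ(γ) · ρ(γ)̃ = 1`**: for `a d − N b c′ = 1` (i.e. `γ = (a b; Nc′ d) ∈ Γ₀(N)`), the frame element
`ρ(γ) = a·e + b·ψ + c′·φ + d·e'` times Orlov's `ρ(γ)̃ = d·e − b·ψ − c′·φ + a·e'` (`= ρ(γ⁻¹)`) is `1` — the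
three-line check behind «`U(Y × Ŷ) ⊇ Γ₀(N)`» (the cell's (AUT_δ)); DERIVED from
[cite: Orlov2002DerivedAbelian, Def 2.17] with Ex. 4.16's `φ_M ∘ φ_L = N`. -/
theorem polFrame_mul_tilde (h1 : e + e' = 1) (h2 : e * e' = 0) (h3 : e' * e = 0)
    (hψ₁ : e * ψ = ψ) (hψ₂ : ψ * e' = ψ) (hφ₁ : e' * φ = φ) (hφ₂ : φ * e = φ)
    (hN₁ : ψ * φ = N • e) (hN₂ : φ * ψ = N • e') {a b c' d : ℤ} (hdet : a * d - N * b * c' = 1) :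
    (a • e + b • ψ + c' • φ + d • e') * (d • e + (-b) • ψ + (-c') • φ + a • e') = 1 := by
  rw [polFrame_mul h1 h2 h3 hψ₁ hψ₂ hφ₁ hφ₂ hN₁ hN₂, ← h1]
  have hcoef : a * d + N * b * -c' = 1 := by linear_combination hdet
  have hcoef' : N * c' * -b + d * a = 1 := by linear_combination hdet
  rw [hcoef, hcoef']
  module

/-- **`ρ(γ)̃ · ρ(γ) = 1`**, the other order (so `ρ(γ)̃` is the two-sided inverse `ρ(γ⁻¹)`).
DERIVED from [cite: Orlov2002DerivedAbelian, Def 2.17]. -/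
theorem polFrame_tilde_mul (h1 : e + e' = 1) (h2 : e * e' = 0) (h3 : e' * e = 0)
    (hψ₁ : e * ψ = ψ) (hψ₂ : ψ * e' = ψ) (hφ₁ : e' * φ = φ) (hφ₂ : φ * e = φ)
    (hN₁ : ψ * φ = N • e) (hN₂ : φ * ψ = N • e') {a b c' d : ℤ} (hdet : a * d - N * b * c' = 1) :
    (d • e + (-b) • ψ + (-c') • φ + a • e') * (a • e + b • ψ + c' • φ + d • e') = 1 := by
  rw [polFrame_mul h1 h2 h3 hψ₁ hψ₂ hφ₁ hφ₂ hN₁ hN₂, ← h1]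
  have hcoef : d * a + N * -b * c' = 1 := by linear_combination hdet
  have hcoef' : N * -c' * b + a * d = 1 := by linear_combination hdet
  rw [hcoef, hcoef']
  module

end Frame

section GammaZero

open CongruenceSubgroup

/-- Entries of `γ ∈ Γ₀(N)`: `N ∣ γ₁₀`, hence `γ₁₀ = N · (γ₁₀ / N)`. [folklore] -/
private theorem gamma0_entry_dvd {N : ℕ} [NeZero N] {γ : SL(2, ℤ)} (hγ : γ ∈ Gamma0 N) :
    (N : ℤ) ∣ (γ : Matrix (Fin 2) (Fin 2) ℤ) 1 0 := by
  rw [Gamma0_mem] at hγ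
  exact (ZMod.intCast_zmod_eq_zero_iff_dvd _ _).1 hγ

/-- Determinant of `γ ∈ Γ₀(N)` in the form `a d − N b c′ = 1`, `c′ = γ₁₀ / N`. [folklore] -/
private theorem gamma0_det {N : ℕ} [NeZero N] {γ : SL(2, ℤ)} (hγ : γ ∈ Gamma0 N) :
    (γ : Matrix (Fin 2) (Fin 2) ℤ) 0 0 * (γ : Matrix (Fin 2) (Fin 2) ℤ) 1 1 -
      (N : ℤ) * (γ : Matrix (Fin 2) (Fin 2) ℤ) 0 1 * ((γ : Matrix (Fin 2) (Fin 2) ℤ) 1 0 / N) = 1 := by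
  have hd := Matrix.det_fin_two (γ : Matrix (Fin 2) (Fin 2) ℤ)
  rw [γ.det_coe] at hd
  have hc := Int.mul_ediv_cancel' (gamma0_entry_dvd hγ)
  linear_combination -hd - (γ : Matrix (Fin 2) (Fin 2) ℤ) 0 1 * hc

/-- **`Γ₀(N) →* Sˣ`, `γ ↦ ρ(γ) = a·e + b·ψ + (c/N)·φ + d·e'`** (`N ≥ 1`): the polarisation frame of
exponent `N` makes `Γ₀(N)` act by units of `S = End(Y × Ŷ)` that are Orlov-isometric (`ρ(γ)⁻¹ = ρ(γ)̃`,
`polFrame_mul_tilde`). This is the algebraic core of «`U(Y × Ŷ) ⊇ Γ₀(N)`» for a polarisation with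
`φ_{L_δ} φ_L = N` — printed as an EQUALITY when `End = ℤ` [cite: Orlov2002DerivedAbelian, Ex 4.16]; the
containment for general `Y` is the cell's DERIVED reading (sheet §D8 (P1)), whose matrix check is this file. -/
theorem exists_monoidHom_Gamma0 {e e' φ ψ : S} (N : ℕ) [NeZero N] (h1 : e + e' = 1) (h2 : e * e' = 0)
    (h3 : e' * e = 0) (hψ₁ : e * ψ = ψ) (hψ₂ : ψ * e' = ψ) (hφ₁ : e' * φ = φ) (hφ₂ : φ * e = φ)
    (hN₁ : ψ * φ = (N : ℤ) • e) (hN₂ : φ * ψ = (N : ℤ) • e') :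
    ∃ ρ : Gamma0 N →* Sˣ, ∀ γ : Gamma0 N,
      (ρ γ : S) = ((γ : SL(2, ℤ)) : Matrix (Fin 2) (Fin 2) ℤ) 0 0 • e +
        ((γ : SL(2, ℤ)) : Matrix (Fin 2) (Fin 2) ℤ) 0 1 • ψ +
        (((γ : SL(2, ℤ)) : Matrix (Fin 2) (Fin 2) ℤ) 1 0 / N) • φ +
        ((γ : SL(2, ℤ)) : Matrix (Fin 2) (Fin 2) ℤ) 1 1 • e' := by
  -- the unit attached to `γ`
  let val : SL(2, ℤ) → S := fun γ =>
    (γ : Matrix (Fin 2) (Fin 2) ℤ) 0 0 • e + (γ : Matrix (Fin 2) (Fin 2) ℤ) 0 1 • ψ +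
      ((γ : Matrix (Fin 2) (Fin 2) ℤ) 1 0 / N) • φ + (γ : Matrix (Fin 2) (Fin 2) ℤ) 1 1 • e'
  let inv : SL(2, ℤ) → S := fun γ =>
    (γ : Matrix (Fin 2) (Fin 2) ℤ) 1 1 • e + (-(γ : Matrix (Fin 2) (Fin 2) ℤ) 0 1) • ψ +
      (-((γ : Matrix (Fin 2) (Fin 2) ℤ) 1 0 / N)) • φ + (γ : Matrix (Fin 2) (Fin 2) ℤ) 0 0 • e'
  have hunit : ∀ γ : Gamma0 N, val γ * inv γ = 1 ∧ inv γ * val γ = 1 := fun γ =>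
    ⟨polFrame_mul_tilde h1 h2 h3 hψ₁ hψ₂ hφ₁ hφ₂ hN₁ hN₂ (gamma0_det γ.2),
      polFrame_tilde_mul h1 h2 h3 hψ₁ hψ₂ hφ₁ hφ₂ hN₁ hN₂ (gamma0_det γ.2)⟩
  let u : Gamma0 N → Sˣ := fun γ => ⟨val γ, inv γ, (hunit γ).1, (hunit γ).2⟩
  have hmul : ∀ γ₁ γ₂ : Gamma0 N, u (γ₁ * γ₂) = u γ₁ * u γ₂ := by
    intro γ₁ γ₂
    ext
    change val ((γ₁ : SL(2, ℤ)) * γ₂) = val γ₁ * val γ₂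
    simp only [val, Matrix.SpecialLinearGroup.coe_mul]
    set A := ((γ₁ : SL(2, ℤ)) : Matrix (Fin 2) (Fin 2) ℤ) with hA
    set B := ((γ₂ : SL(2, ℤ)) : Matrix (Fin 2) (Fin 2) ℤ) with hB
    have hN0 : (N : ℤ) ≠ 0 := by exact_mod_cast (NeZero.ne N)
    have hc₁ : (N : ℤ) * (A 1 0 / N) = A 1 0 := Int.mul_ediv_cancel' (gamma0_entry_dvd γ₁.2)
    have hc₂ : (N : ℤ) * (B 1 0 / N) = B 1 0 := Int.mul_ediv_cancel' (gamma0_entry_dvd γ₂.2)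
    have h10 : (A * B) 1 0 / N = A 1 0 / N * B 0 0 + A 1 1 * (B 1 0 / N) := by
      have h : (A * B) 1 0 = N * (A 1 0 / N * B 0 0 + A 1 1 * (B 1 0 / N)) := by
        rw [Matrix.mul_apply, Fin.sum_univ_two]
        linear_combination (-(B 0 0)) * hc₁ - A 1 1 * hc₂
      rw [h, Int.mul_ediv_cancel_left _ hN0]
    have e00 : A 0 0 * B 0 0 + A 0 1 * B 1 0 = A 0 0 * B 0 0 + N * A 0 1 * (B 1 0 / N) := by
      linear_combination (-(A 0 1)) * hc₂
    have e11 : A 1 0 * B 0 1 + A 1 1 * B 1 1 = N * (A 1 0 / N) * B 0 1 + A 1 1 * B 1 1 := by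
      linear_combination (-(B 0 1)) * hc₁
    rw [h10, polFrame_mul h1 h2 h3 hψ₁ hψ₂ hφ₁ hφ₂ hN₁ hN₂]
    simp only [Matrix.mul_apply, Fin.sum_univ_two]
    rw [e00, e11]
  refine ⟨MonoidHom.mk' u hmul, fun γ => rfl⟩

end GammaZero

end Summit.Ventures.HSemireg
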